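import Summits.FinalStateConjecture.FinalStateConjecture.Theorems.SettledCapture.Negative.SoundRetype
import Summits.FinalStateConjecture.FinalStateConjecture.Theorems.BartnikGapSettlingSettledCaptureStubVisibleRaysStay
import Literature.Geometry.Lorentzian.KerrStabilitySubextremalCauchy
import Literature.Geometry.Lorentzian.HintzGluedEMRIData
import Literature.Geometry.Lorentzian.KerrAdaptedLayerNorm
import HarnessLib

/-!
# Line `kerr-capped-twin` for crux `SettledCapture` (stmt-FinalStateConjecture-17328), route
`BartnikGapSettling` — CHECKED SKELETON concluding the RE-TYPED crux
`Theorems.SettledCapture.Retype.SoundSettledCapture` (p153807) BY NAME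

Planner `planner-cruxplan-stmt-FinalStateConjecture-17328-kerr-capped-twin-0`, 2026-08-17.
Idea card `Cruxes/SettledCapture/Ideas/kerr-capped-twin.md` (triage r1-1/r1-2/r1-3: pass); line card
`Cruxes/SettledCapture/Lines/kerr-capped-twin.md`.

## Why the conclusion is the RE-TYPED decl and not `Theses.BartnikGapSettling.SettledCapture`

The typed crux carries the idle 40-binder leaf block of `CauchyDevelopment.IsNearKerrLeaf` (THE DODGE;
kernel anchors p122244/p122576/p122817/p123910, `Negative/TypedNormalForm.lean` p146299) and stands
`verdict: misstated` twice (refuter-rattack 07:21Z, lead -0 09:31Z, 2026-08-17); every skeleton concluding it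
by name needs a stub that consumes the idle block, i.e. the non-generic T2 settling statement, paper-false
modulo extremal end states (lines `birth`, `Sketch` and the four `Capture` lines died there). The re-typed
text `SoundSettledCapture` (hypotheses = `SoundCapture` p125313 verbatim, leaf block over
`CauchyDevelopment.IsSoundNearKerrLeaf`; conclusion = the T2 clause verbatim) LANDED as
`Theorems/SettledCapture/Negative/SoundRetype.lean` (p153807) and `soundSettledCapture_of_settledCapture`
shows re-typing WEAKENS the item. This file is the `kerr-capped-twin` line for that text; §6 records the
one-line reduction of the typed decl to it modulo the (unprovable, paper-false) converse.

## The line (one engine, six registered stubs)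

For a late SOUND `(ε,k)`-leaf the hole chart `Ψᵢ` certifies, in Cartesian Kerr–Schild coordinates of the
rest frame of hole `i`, the full `k`-jet of `g` on the LAYER `{−1 < t*ᵢ < 1, rᵢ ≤ Rᵢ}` over the
horizon-penetrating region `{rᵢ > Mᵢ}` with `Rᵢ ≥ 2Mᵢ` (clauses (S₁), (S₂) of `IsSoundNearKerrLeaf`).
Read the induced data on the disc `{t*ᵢ = 0, Mᵢ < rᵢ, ‖y‖ < 4R}` and CAP them (`stub_capping`: charge-matched
annulus gluing on `{R ≤ ‖y‖ ≤ 2R}`): a vacuum datum `D′` on Hintz's slice `Kerr.slice a′ (ρ₀ M′)` equal (as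
coordinate readings, up to one rotation of the axis) to the disc data on `{‖y‖ ≤ R}` and EXACTLY
`Kerr.data M′ a′` outside `2R`, `|M′ − Mᵢ| + |a′ − aᵢ| ≤ Cε`, at weighted distance `≤ C(s,δ,R) ε` from
`Kerr.data M′ a′` at every order and weight. Its MGHDs (the TWIN) settle by Hintz's Cauchy claim
(`stub_hintzClaimAllOrders`). The true development `𝒟` contains the `2R`-disc as a data hypersurface and, by
lateness (`stub_lateConesQuiet`: finite Bondi budget + far-tail transport + recession), a Kerr-adapted far
layer through which the Kerr-relative INFLOW — the in-tree `r^p` and transversal fluxes of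
`KerrAdaptedLayerNorm.lean` at Thrifty's exponents `(p, δ) = (1/2, 1/2)` — is `≤ δ*`. THE ENGINE
(`stub_robustCapture`, hardest): Hintz-basin capped Cauchy datum on the disc + `δ*`-small far inflow ⇒ the
development returns, at all later layer times, to Kerr-adapted layers of vanishing layer norm around a
SUB-EXTREMAL `Kerr(M″,a″)` `η`-close to `(M′,a′)` — a perturbation problem with an ARBITRARILY SMALL
parameter `δ*` (decoupled from the leaf tolerance `ε`) around a background that already settles at Hintz's
rates. `stub_twinAssembly` turns capping + engine + quiet cones into the exterior T2 format (disc-to-data,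
rest frame and rotation, choice `R ≫ 1/m₀`, `ε ≤ min(ε_cap(R), ε₄/C(R))`, lateness until inflow `< δ*`,
layer-to-slab transfer, shell outside the last cone by Klainerman–Nicolò exterior stability, multi-centre
synthesis for `N ≥ 2`, honest radii, orientation, exhaustion). The rays clause is the existential cut
`stub_raysCompletion` (honest exterior decomposition ⇒ one with cofinally visible complete rays; lines
`null-concave-crush` / `tendril-swarm-rays`), glued to the LANDED causal lemma `stub_visibleRaysStay`
(p149576) in `SoundSettledCapture_of`, which is sorry-free.

Disproof used: no `Cruxes/SettledCapture/Disproof.lean` exists (payload path absent on disk, `crux ls`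
2026-08-17T11:4xZ). Landed Negative lemmas honoured: `Negative/TypedNormalForm` (the typed decl is not
targeted), `Negative/InheritsCapture` (idem), `Negative/SoundRetype` (target = its `SoundSettledCapture`;
anti-vacuity `allSoundHyps_minkowski_of_mghdExists`: at the Minkowski column every stub below is consistent —
`N = 0`, no disc, no twin, `stub_twinAssembly` must dispatch `N = 0` by dispersal).
-/

set_option linter.dupNamespace false
set_option linter.unusedVariables false

noncomputable section

namespace Summit.FinalStateConjecture.FinalStateConjecture.Cruxes.SettledCapture.KerrCappedTwin

open scoped Manifold ContDiff ENNReal Topology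
open Set Filter TopologicalSpace
open Literature.Geometry.Lorentzian
open Summit.FinalStateConjecture.FinalStateConjecture.Theorems.SettledCapture.Retype (SoundSettledCapture SoundLeafHyp)
open Summit.FinalStateConjecture.FinalStateConjecture.Theorems.SettledCapture.Negative (T2Conclusion)

/-! ## §1 Objects of the line (definitions; all over existing declarations) -/

/-- Hintz's normalised inner radius for the margin `χ`: `ρ₀(χ) = 1 + √(1 − χ²)/2`, which lies in the
admissible window `(1 − √(1 − χ₀²), 1 + √(1 − χ₀²))` of EVERY centre `|χ₀| ≤ χ` and puts
`r₀ = ρ₀(χ) M ∈ (r₋, r₊)` strictly inside the horizons of every `Kerr(M, a)` with `|a| ≤ χ M`, while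
`r₀ > M` (the hole charts of a leaf live on `Kerr.region a M = {r > M}`). [folklore] -/
def rho0 (χ : ℝ) : ℝ := 1 + Real.sqrt (1 - χ ^ 2) / 2

/-- The one-hole Kerr-adapted LAYER of scale `R` based at lab time `τ` for `Kerr(M, a)` at rest at the
origin (`KerrAdapted.layer` with `N = 1`, `Λ = 1`, `ξ = 0`): leaves `{s = s₀}`, `0 < s₀ < R`, asymptotic to
the outgoing null cones (tortoise logarithm included), near part `{|x̲| ≤ R}`, far part `{|x̲| ≥ R}`, cores
`{r ≤ M}` excised. [cite: KlainermanSzeftel2023, §3.1] -/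
abbrev twinLayer (M a τ R : ℝ) : Opens E4 :=
  KerrAdapted.layer (fun _ : Fin 1 ↦ M) (fun _ ↦ a) (fun _ ↦ (1 : lorentzGroup)) (fun _ ↦ (0 : E3)) τ R

/-- Its reference background (Kerr–Schild form of `Kerr(M,a)` at rest, layer time `s`). [folklore] -/
abbrev twinBackground (M a τ R : ℝ) : ModelBackground :=
  KerrAdapted.background (fun _ : Fin 1 ↦ M) (fun _ ↦ a) (fun _ ↦ (1 : lorentzGroup)) (fun _ ↦ (0 : E3)) τ R

/-- **Kerr-relative far INFLOW of order `k`** of a layer chart `Φ` of the spacetime `𝓢`: the far part of the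
Kerr-adapted layer norm of `KerrAdaptedLayerNorm.lean` — `(rpFlux k p h̃)^{1/2} + (transversalFlux k δ h̃)^{1/2}`,
`h̃ = Φ^* g − g_{M,a}` extended by zero — at the exponents `(p, δ) = (1/2, 1/2)` of
`Theses.DerivativeThrift.ThriftyKerrStability`. Since the outgoing null cone from the sphere
`{s = 0, |x̲| = R}` runs inside the far layer and every incoming null ray with `v ≥ v(R)` crosses the leaves,
this measures (by the `r^p` energy identity, DR arXiv:0910.4957 §3) all radiation entering the near zone's
future through that cone, relative to `Kerr(M,a)`. [cite: DafermosRodnianski2010ICMP, §3–§4] -/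
def farInflow (𝓢 : Spacetime.{0} 4) (M a τ R : ℝ) (k : ℕ) (Φ : twinLayer M a τ R → 𝓢.carrier) : ℝ≥0∞ :=
  KerrAdapted.rpFlux (fun _ : Fin 1 ↦ M) (fun _ ↦ a) (fun _ ↦ (1 : lorentzGroup)) (fun _ ↦ (0 : E3)) τ R k
      (1 / 2) (𝓢.deviationExtend (twinBackground M a τ R) Φ) ^ (1 / 2 : ℝ) +
    KerrAdapted.transversalFlux (fun _ : Fin 1 ↦ M) (fun _ ↦ a) (fun _ ↦ (1 : lorentzGroup))
      (fun _ ↦ (0 : E3)) τ R k (1 / 2) (𝓢.deviationExtend (twinBackground M a τ R) Φ) ^ (1 / 2 : ℝ)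

/-- The full Kerr-adapted layer norm (near `Cᵏ` sup + far inflow) at the same exponents. [cite: KlainermanSzeftel2023, §3.6] -/
def layerNorm (𝓢 : Spacetime.{0} 4) (M a τ R : ℝ) (k : ℕ) (Φ : twinLayer M a τ R → 𝓢.carrier) : ℝ≥0∞ :=
  𝓢.kerrAdaptedLayerNorm (fun _ : Fin 1 ↦ M) (fun _ ↦ a) (fun _ ↦ (1 : lorentzGroup)) (fun _ ↦ (0 : E3)) τ R
    k (1 / 2) (1 / 2) Φ

/-- The open `ρ`-disc of the Kerr–Schild slice `{t* = 0, r > max r₀ 0}` of spin `a`: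
`{y ∈ Kerr.slice a r₀ | ‖y‖ < ρ}`, an open subset of `E3`. [cite: arXiv08110354, §5.1] -/
def sliceDisc (a r₀ ρ : ℝ) : Opens E3 :=
  ⟨{y | y ∈ (Kerr.slice a r₀ : Set E3) ∧ ‖y‖ < ρ},
    (Kerr.slice a r₀).isOpen.inter (isOpen_lt continuous_norm continuous_const)⟩

/-- **`ι` embeds the `ρ`-disc of the datum `Dc` into the development `𝒟` as a DATA HYPERSURFACE**: the
four clauses of `DataEmbedding` for the map `ι` from the disc — smooth embedding, a future unit normal `ν`,
induced first fundamental form = the coordinate reading `coordHOn Dc`, induced second fundamental form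
(w.r.t. `ν`, Levi-Civita connection of `g`) = the reading `coordKOn Dc` — plus: the image lies in the causal
future of the Cauchy hypersurface of `𝒟`. (So `𝒟` and any development of `Dc` contain isometric copies of
the future domain of dependence of the disc: Choquet-Bruhat–Geroch local uniqueness.)
[cite: Ringstrom2009, Def. 16.3 and Thm. 16.6] -/
def InducesDataOn {X : Type} [TopologicalSpace X] [ChartedSpace E3 X] [IsManifold (𝓡 3) ∞ X]
    [ConnectedSpace X] {D : InitialDataSet (𝓡 3) X} (𝒟 : CauchyDevelopment D)
    {U : Opens E3} (Dc : InitialDataSet 𝓘(ℝ, E3) U) (a r₀ ρ : ℝ) (ι : sliceDisc a r₀ ρ → 𝒟.carrier) :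
    Prop :=
  Manifold.IsSmoothEmbedding 𝓘(ℝ, E3) (𝓡 4) ∞ ι ∧
    range ι ⊆ 𝒟.metric.causalFuture 𝒟.timeOrientation (range 𝒟.embed) ∧
    ∃ ν : NormalField (𝓡 4) ι,
      𝒟.metric.IsFutureUnitNormal 𝓘(ℝ, E3) 𝒟.timeOrientation ι ν ∧
      (∀ y : sliceDisc a r₀ ρ,
        pullbackBilin (I := 𝓡 4) (I' := 𝓘(ℝ, E3)) ι 𝒟.metric.val y = Dc.coordHOn (y : E3)) ∧
      ∀ [𝒟.metric.toPseudoRiemannianMetric.HasLeviCivita], ∀ y : sliceDisc a r₀ ρ,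
        𝒟.metric.toPseudoRiemannianMetric.secondFundamentalForm 𝓘(ℝ, E3) ι ν y =
          (Dc.coordKOn (y : E3)).toLinearMap₁₂

/-- `Cᵏ` sup-closeness (tolerance `ε`) of the coordinate readings of two data on open subsets of `E3`, over a
set `S ⊆ E3`. [folklore] -/
def ReadingsCloseOn {U V : Opens E3} (D₁ : InitialDataSet 𝓘(ℝ, E3) U) (D₂ : InitialDataSet 𝓘(ℝ, E3) V)
    (k : ℕ) (S : Set E3) (ε : ℝ) : Prop :=
  ∀ y ∈ S, ∀ m : ℕ, m ≤ k →
    ‖iteratedFDeriv ℝ m (fun z ↦ D₁.coordHOn z - D₂.coordHOn z) y‖ ≤ ε ∧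
      ‖iteratedFDeriv ℝ m (fun z ↦ D₁.coordKOn z - D₂.coordKOn z) y‖ ≤ ε

/-- The readings of `D₁` at `y` are those of `D₂` at `ρ y` pulled back by the linear isometry `ρ` of `E3`
(rotation of the spin axis). [folklore] -/
def SameReadingUpTo {U V : Opens E3} (D₁ : InitialDataSet 𝓘(ℝ, E3) U) (D₂ : InitialDataSet 𝓘(ℝ, E3) V)
    (ρ : E3 →L[ℝ] E3) (y : E3) : Prop :=
  D₁.coordHOn y = (D₂.coordHOn (ρ y)).bilinearComp ρ ρ ∧ D₁.coordKOn y = (D₂.coordKOn (ρ y)).bilinearComp ρ ρ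

/-! Sanity of §1 (elaboration only). -/
example (χ : ℝ) : rho0 χ = 1 + Real.sqrt (1 - χ ^ 2) / 2 := rfl

/-! ## §2 Statements of the six stubs (named closed `Prop`s) and of the assembly's target -/

/-- **S1 — EXTERIOR KERR CAPPING (charge-matched annulus gluing to EXACT Kerr at finite radius).**
For a margin `χ < 1` and a mass window `[m₀, 1/m₀]` there is a gluing radius `R₀`; for every `R ≥ R₀` and
every target order/weight `(s, δ)` there are an input order `k₁`, a tolerance `ε₀` and a constant `C` such
that: vacuum data `Din` on an open `U ⊇ {M < r_a(0,y), ‖y‖ < 4R}` whose coordinate readings are `ε`-close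
in `C^{k₁}` (`ε ≤ ε₀`) to those of `Kerr.data M a M` (`|a| ≤ χ M`, `M` in the window) can be CAPPED: there
are parameters `(M′, a′)` with `|M′ − M| + |a′ − a| ≤ C ε` (in the window/margin of `((1+χ)/2, m₀/2)`), a
rotation `ρ` of `E3` with `‖ρ − 1‖ ≤ C ε/(|a| + ε)` (the cokernel `{∂_t, ∂_φ}`, resp. `{∂_t, Ω₁, Ω₂, Ω₃}`
through `a = 0`, absorbed by `(M, J⃗)`, Li–Mei Prop. 4.1 / Corvino–Schoen / Chruściel–Delay §8), and a
vacuum datum `Dc` on Hintz's slice `Kerr.slice a′ (ρ₀((1+χ)/2) M′)` whose readings are the input's read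
through `ρ` on `{‖y‖ ≤ R}`, EXACTLY those of `Kerr.data M′ a′` on `{‖y‖ ≥ 2R}`, b-conormal at every order
(compactly supported difference) and `C ε`-close at order `s`, weight `δ`, to `Kerr.data M′ a′`.
Size L; in print only asymptotically (`R → ∞` tied to `ε`, Corvino–Schoen JDG 73 (2006)) or on interior
cylinders (Li–Mei CMP 378 (2020) Prop. 4.1, `LiMei.interiorKerrGluing`); the finite-`R`, uniform-through-`a = 0`
form is the card's falsifier (b). [cite: CorvinoSchoen2006, Thm. 1] -/
def ExteriorKerrCapping : Prop :=
  ∀ [Kerr.Facts] [Kerr.SliceFacts], ∀ (χ m₀ : ℝ) (hχ₀ : 0 ≤ χ) (hχ : χ < 1) (hm₀ : 0 < m₀),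
    ∃ R₀ : ℝ, 0 < R₀ ∧ ∀ R : ℝ, R₀ ≤ R → ∀ (s : ℕ) (δ : ℝ),
      ∃ (k₁ : ℕ) (ε₀ C : ℝ), 0 < ε₀ ∧ 0 ≤ C ∧
        ∀ (M a : ℝ) (hM : m₀ ≤ M), M ≤ m₀⁻¹ → |a| ≤ χ * M → ∀ (ε : ℝ), 0 < ε → ε ≤ ε₀ →
          ∀ (U : Opens E3) (Din : InitialDataSet 𝓘(ℝ, E3) U) [Din.metric.HasLeviCivita],
            {y : E3 | M < Kerr.radius a (E4.ofTimeSpace 0 y) ∧ ‖y‖ < 4 * R} ⊆ (U : Set E3) →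
            (∀ y : U, ‖(y : E3)‖ < 4 * R →
              Din.hamiltonianConstraintFn y = 0 ∧ Din.momentumConstraintFn y = 0) →
            ReadingsCloseOn Din (Kerr.data M a M (hm₀.le.trans hM)) k₁
              {y : E3 | M < Kerr.radius a (E4.ofTimeSpace 0 y) ∧ ‖y‖ < 4 * R} ε →
            ∃ (M' a' : ℝ) (hM' : m₀ / 2 ≤ M') (ρ : E3 ≃ₗᵢ[ℝ] E3)
              (Dc : InitialDataSet 𝓘(ℝ, E3) (Kerr.slice a' (rho0 ((1 + χ) / 2) * M')))
              (_ : Dc.metric.HasLeviCivita),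
              M' ≤ (m₀ / 2)⁻¹ ∧ |a'| ≤ (1 + χ) / 2 * M' ∧ |M' - M| + |a' - a| ≤ C * ε ∧
              ‖(ρ : E3 →L[ℝ] E3) - ContinuousLinearMap.id ℝ E3‖ ≤ C * ε / (|a| + ε) ∧
              Dc.IsVacuumConstraintSolution ∧
              (∀ y : E3, y ∈ (Kerr.slice a' (rho0 ((1 + χ) / 2) * M') : Set E3) → ‖y‖ ≤ R →
                SameReadingUpTo Dc Din (ρ : E3 →L[ℝ] E3) y) ∧
              (∀ y : E3, 2 * R ≤ ‖y‖ →
                Dc.coordHOn y =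
                    (Kerr.data M' a' (rho0 ((1 + χ) / 2) * M')
                      ((div_nonneg hm₀.le zero_le_two).trans hM')).coordHOn y ∧
                  Dc.coordKOn y =
                    (Kerr.data M' a' (rho0 ((1 + χ) / 2) * M')
                      ((div_nonneg hm₀.le zero_le_two).trans hM')).coordKOn y) ∧
              (∀ s' : ℕ, InitialDataSet.dataWeightedSobolevEDist s' δ Dc
                (Kerr.data M' a' (rho0 ((1 + χ) / 2) * M')
                  ((div_nonneg hm₀.le zero_le_two).trans hM')) < ⊤) ∧
              InitialDataSet.dataWeightedSobolevEDist s δ Dc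
                  (Kerr.data M' a' (rho0 ((1 + χ) / 2) * M')
                    ((div_nonneg hm₀.le zero_le_two).trans hM')) ≤ ENNReal.ofReal (C * ε)

/-- **S4′ — ROBUST CAPPED CAPTURE (THE ENGINE; the Hintz-basin CAUCHY twin perturbed by small far inflow).**
For a margin `χ < 1` and a mass window there is `R₄`; for every `R ≥ R₄` and tolerance `η > 0` there are a
smallness order/weight `(s₄, δ₄)`, an inflow order `k₄`, a basin `ε₄ > 0` and an INFLOW THRESHOLD `δ* > 0`
(all uniform over `M ∈ [m₀, 1/m₀]`, `|a| ≤ χ M`: margin + scaling) such that: if `Dc` is a vacuum datum on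
Hintz's slice `Kerr.slice a (ρ₀(χ) M)`, b-conormal at weight `δ₄` and `ε₄`-close at order `s₄` to
`Kerr.data M a` (Hintz's hypotheses (13.1a,b) — so every MGHD of `Dc`, the TWIN, settles to a sub-extremal
Kerr at Hintz's rates, by the claim), and `𝒟` is ANY maximal vacuum Cauchy development of admissible data
carrying ONE chart `Ξ` of an open `W ⊆ E4` (smooth open embedding into `J⁺(Σ)`) which (i) embeds the
`2R`-disc `{t* = 0} × {‖y‖ < 2R}` of `Dc` as a DATA HYPERSURFACE of `𝒟` (`InducesDataOn`), (ii) is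
time-oriented on the Kerr-adapted layer of scale `R` based at `τ = 0`, and (iii) has Kerr-relative FAR
INFLOW of order `k₄` through that layer `≤ δ*` — then `𝒟` is CAPTURED: there is a SUB-EXTREMAL `(M₁, a₁)`
with `|M₁ − M| + |a₁ − a| ≤ η` such that for every `ϵ > 0`, at all sufficiently late base times `τ`, `𝒟`
carries a time-oriented Kerr-adapted layer chart of scale `R` for `Kerr(M₁, a₁)`, inside `J⁺(Ξ(W))`, of full
layer norm (near `C²` sup + far fluxes) `≤ ϵ`. The twin and `𝒟` share the future domain of dependence of
the disc (CBG uniqueness); beyond it they are two developments of the same (disc ∪ cone)-characteristic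
problem whose cone data differ by the twin's gluing-layer radiation (in Hintz's class) and by the inflow
(iii): the content is CHARACTERISTIC ROBUSTNESS of the compact family of Hintz-basin backgrounds under
`δ*`-inflow at weight `p = 1/2 < 1`, rate-free conclusion, `δ*` independent of the leaf tolerance. Beyond
print on two counts (characteristic inflow; `p < 1`, Hintz Rem. 1.3); linear model in the full
sub-extremal range: DRSR arXiv:1402.7034 (boundedness + ILED), scattering arXiv:1412.8379; nonlinear
templates: Hintz arXiv:2606.28253 Thm. 13.1, DHRT arXiv:2104.08222, KS arXiv:2104.11857. Size XL /
open-problem. Nearest in-tree statement: `Theses.DerivativeThrift.ThriftyKerrStability` (layer data with ONE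
`ε` for near + far, no twin). [cite: Hintz2026, Thm. 13.1 (pp. 318–319) and Remark 1.3 (p. 3)] -/
def RobustCappedCapture : Prop :=
  ∀ [Kerr.Facts] [Kerr.SliceFacts], ∀ (χ m₀ : ℝ) (hχ₀ : 0 ≤ χ) (hχ : χ < 1) (hm₀ : 0 < m₀),
    ∃ R₄ : ℝ, 0 < R₄ ∧ ∀ R : ℝ, R₄ ≤ R → ∀ η : ℝ, 0 < η →
      ∃ (s₄ : ℕ) (δ₄ : ℝ) (k₄ : ℕ) (ε₄ δs : ℝ), 0 < ε₄ ∧ 0 < δs ∧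
        ∀ (M a : ℝ) (hM : m₀ ≤ M), M ≤ m₀⁻¹ → |a| ≤ χ * M →
          ∀ (Dc : InitialDataSet 𝓘(ℝ, E3) (Kerr.slice a (rho0 χ * M))) [Dc.metric.HasLeviCivita],
            Dc.IsVacuumConstraintSolution →
            (∀ s' : ℕ, InitialDataSet.dataWeightedSobolevEDist s' δ₄ Dc
              (Kerr.data M a (rho0 χ * M) (hm₀.le.trans hM)) < ⊤) →
            InitialDataSet.dataWeightedSobolevEDist s₄ δ₄ Dc
                (Kerr.data M a (rho0 χ * M) (hm₀.le.trans hM)) < ENNReal.ofReal ε₄ →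
            ∀ (X : Type) [TopologicalSpace X] [ChartedSpace E3 X] [IsManifold (𝓡 3) ∞ X] [T2Space X]
              [SecondCountableTopology X] [ConnectedSpace X], ∀ D ∈ admissibleVacuumData X,
            ∀ 𝒟 : VacuumCauchyDevelopment D, 𝒟.IsMaximal →
              ∀ (W : Opens E4) (Ξ : W → 𝒟.carrier)
                (hW₁ : ∀ y : E3, y ∈ (sliceDisc a (rho0 χ * M) (2 * R) : Set E3) → E4.ofTimeSpace 0 y ∈ W)
                (hW₂ : (twinLayer M a 0 R : Set E4) ⊆ W),
                ContMDiff 𝓘(ℝ, E4) (𝓡 4) ∞ Ξ → Topology.IsOpenEmbedding Ξ →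
                range Ξ ⊆ 𝒟.metric.causalFuture 𝒟.timeOrientation (range 𝒟.embed) →
                InducesDataOn 𝒟.toCauchyDevelopment Dc a (rho0 χ * M) (2 * R)
                  (fun y ↦ Ξ ⟨E4.ofTimeSpace 0 (y : E3), hW₁ y y.2⟩) →
                (∀ x : twinLayer M a 0 R, 𝒟.timeOrientation.IsFutureDirected
                  (mfderiv 𝓘(ℝ, E4) (𝓡 4) Ξ ⟨x.1, hW₂ x.2⟩ (Kerr.timeVector M a x.1))) →
                farInflow 𝒟.toSpacetime M a 0 R k₄ (fun x ↦ Ξ ⟨x.1, hW₂ x.2⟩) ≤ ENNReal.ofReal δs →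
                ∃ (M₁ a₁ : ℝ), Kerr.IsSubextremal M₁ a₁ ∧ |M₁ - M| + |a₁ - a| ≤ η ∧
                  ∀ ϵ : ℝ, 0 < ϵ → ∃ τ₁ : ℝ, ∀ τ : ℝ, τ₁ ≤ τ →
                    ∃ Φ : twinLayer M₁ a₁ τ R → 𝒟.carrier,
                      ContMDiff 𝓘(ℝ, E4) (𝓡 4) ∞ Φ ∧ Topology.IsOpenEmbedding Φ ∧
                      range Φ ⊆ 𝒟.metric.causalFuture 𝒟.timeOrientation (range Ξ) ∧
                      (∀ x : twinLayer M₁ a₁ τ R, 𝒟.timeOrientation.IsFutureDirected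
                        (mfderiv 𝓘(ℝ, E4) (𝓡 4) Φ x (Kerr.timeVector M₁ a₁ x.1))) ∧
                      layerNorm 𝒟.toSpacetime M₁ a₁ τ R 2 Φ ≤ ENNReal.ofReal ϵ

/-- **S5 — LATE CONES ARE QUIET (lateness ⇒ small Kerr-relative far inflow; the ε-independent input).**
In a maximal vacuum Cauchy development of an admissible datum with complete `𝓘⁺` and SOUND near-Kerr leaves
beyond every compact set at every tolerance: for every scale `R > 0`, order `k` and `δ* > 0` there are a
fineness `(kq, εq)` and a compact `K` such that every sound `(ε, k')`-leaf with `kq ≤ k'`, `ε ≤ εq` lying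
beyond `J⁻(K)` admits, hole by hole, ONE rest-frame chart `Ξᵢ` of an open `Wᵢ ⊆ E4` containing the
Kerr–Schild layer `{−1 < x⁰ < 1, Mᵢ < r < 4R + 1}` and the Kerr-adapted layer of scale `R` at `τ = 0`:
a smooth open embedding into `J⁺(Σ)`, charting a piece of the leaf (`Ξᵢ({0} × disc) ⊆ S`, discs pairwise
disjoint), certified `ε`-close in `C^{k'}` to `Kerr(Mᵢ, aᵢ)` AT REST on the Kerr–Schild layer, time-oriented on
the adapted layer, with far inflow of order `k` `≤ δ*`. Mechanism: the inflow through a late outgoing cone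
is (α) the far tail of the `o₂(r⁻¹)` admissible datum transported `u`-uniformly (rate-free at `p = 1/2 < 1`),
(β) back-scatter of earlier outgoing radiation and (γ) the companions' fields, all bounded by the finite
lifetime Bondi budget (`m_B` monotone, `≥ 0`) and recession; a `∀`-MGHD far-zone theorem for ALL retarded
times, in print only for `u ≤ u₀` (Klainerman–Nicolò 2003; Shen arXiv:2303.12758) — the LEDGER / FAR-TAIL
levers of the sibling cards, with the sibling line's `IsTameFarFrameWithBoostedTail` as nearest typed
relative. Size L–XL. [cite: KlainermanNicolo2003, Thm. 1.1] [cite: DafermosRodnianski2010ICMP, §3–§4] -/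
def LateConesQuiet : Prop :=
  ∀ (X : Type) [TopologicalSpace X] [ChartedSpace E3 X] [IsManifold (𝓡 3) ∞ X] [T2Space X]
    [SecondCountableTopology X] [ConnectedSpace X], ∀ D ∈ admissibleVacuumData X,
    ∀ 𝒟 : VacuumCauchyDevelopment D, 𝒟.IsMaximal →
      Summit.FinalStateConjecture.HasCompleteNullInfinity 𝒟.toCauchyDevelopment → SoundLeafHyp 𝒟 →
      ∀ (R : ℝ), 0 < R → ∀ (k : ℕ) (δs : ℝ), 0 < δs →
        ∃ (kq : ℕ) (εq : ℝ≥0∞) (K : Set 𝒟.carrier), 0 < εq ∧ IsCompact K ∧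
          ∀ (k' : ℕ) (ε : ℝ≥0∞), kq ≤ k' → ε ≤ εq →
          ∀ (N : ℕ) (M a : Fin N → ℝ) (S : Set 𝒟.carrier),
            𝒟.toCauchyDevelopment.IsSoundNearKerrLeaf k' ε N M a S →
            Disjoint S (𝒟.metric.causalPast 𝒟.timeOrientation K) →
            ∃ (W : Fin N → Opens E4) (Ξ : ∀ i, W i → 𝒟.carrier)
              (hW₁ : ∀ i, {x : E4 | -1 < x 0 ∧ x 0 < 1 ∧ M i < Kerr.radius (a i) x ∧
                Kerr.radius (a i) x < 4 * R + 1} ⊆ (W i : Set E4))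
              (hW₂ : ∀ i, (twinLayer (M i) (a i) 0 R : Set E4) ⊆ W i),
              Pairwise (Function.onFun Disjoint fun i ↦
                Ξ i '' {x | x.1 0 = 0 ∧ Kerr.radius (a i) x.1 ≤ 4 * R}) ∧
              ∀ i, ContMDiff 𝓘(ℝ, E4) (𝓡 4) ∞ (Ξ i) ∧ Topology.IsOpenEmbedding (Ξ i) ∧
                range (Ξ i) ⊆ 𝒟.metric.causalFuture 𝒟.timeOrientation (range 𝒟.embed) ∧
                Ξ i '' {x | x.1 0 = 0 ∧ Kerr.radius (a i) x.1 ≤ 4 * R} ⊆ S ∧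
                supCkENorm (Subtype.val '' {x : W i | -1 < x.1 0 ∧ x.1 0 < 1 ∧
                    Kerr.radius (a i) x.1 ≤ 4 * R}) k'
                  (𝒟.toSpacetime.deviationExtend
                    ⟨W i, Kerr.bilin (M i) (a i), fun x ↦ x 0, Kerr.radius (a i)⟩ (Ξ i)) ≤ ε ∧
                (∀ x : twinLayer (M i) (a i) 0 R, 𝒟.timeOrientation.IsFutureDirected
                  (mfderiv 𝓘(ℝ, E4) (𝓡 4) (Ξ i) ⟨x.1, hW₂ i x.2⟩ (Kerr.timeVector (M i) (a i) x.1))) ∧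
                farInflow 𝒟.toSpacetime (M i) (a i) 0 R k (fun x ↦ Ξ i ⟨x.1, hW₂ i x.2⟩) ≤
                  ENNReal.ofReal δs

/-- The EXTERIOR half of the re-typed crux in the T2 format (target of the assembly stub): sound
hypotheses ⇒ a `C²` final-state decomposition `d` of `O = exteriorOf 𝒟 d.charted` with sub-extremal holes,
`HasExhaustiveCharts d`, `IsFutureOriented d` (no rays clause). [cite: DafermosLuk2017, Conjecture 1] -/
def SoundExteriorCaptureT2 : Prop :=
  ∀ (X : Type) [TopologicalSpace X] [ChartedSpace E3 X] [IsManifold (𝓡 3) ∞ X] [T2Space X]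
    [SecondCountableTopology X] [ConnectedSpace X], ∀ D ∈ admissibleVacuumData X,
    ∀ 𝒟 : VacuumCauchyDevelopment D, 𝒟.IsMaximal →
      Summit.FinalStateConjecture.HasCompleteNullInfinity 𝒟.toCauchyDevelopment → SoundLeafHyp 𝒟 →
      ∃ (O : Set 𝒟.carrier) (d : FinalStateDecomposition 𝒟.toSpacetime O 2),
        (∀ i, Kerr.IsSubextremal (d.mass i) (d.spin i)) ∧
          O = Summit.FinalStateConjecture.exteriorOf 𝒟.toCauchyDevelopment d.charted ∧
            Summit.FinalStateConjecture.HasExhaustiveCharts d ∧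
              Summit.FinalStateConjecture.IsFutureOriented d

/-- **S6 — TWIN ASSEMBLY (capping + engine + quiet cones ⇒ the exterior T2 format).** Given S1, S4′ (as a
closed fact) and S5: fix the datum's sound-leaf constants `(N₀, m₀, χ, k₁, ε₁)`; choose
`R ≥ max(R₀, R₄, 8/m₀)` for the capped window `((1+χ)/2, m₀/2)`, then `(s₄, δ₄, k₄, ε₄, δ*)` from S4′ at
`η < (1−χ) m₀/8`, then `(k₁, ε₀, C)` from S1 at `(s₄, δ₄)`, then `(kq, εq, K)` from S5 at `(R, k₄, δ*)`; take
ONE sound leaf at order `max(k₁ + 2, kq, k₁')` and tolerance `ε ≤ min(ε₀, ε₄/C, εq, ε₁, ε_disc(R))` beyond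
`J⁻(K)` (margin clause active). Per hole: S5's rest-frame chart `Ξᵢ`; DISC-TO-DATA — the `t* = 0` slice of
`Ξᵢ` induces a vacuum `InitialDataSet` on `{Mᵢ < r, ‖y‖ < 4R}` with readings `C′ε`-close in `C^{k₁}` to
`Kerr.data Mᵢ aᵢ Mᵢ` (layer certification controls the transversal jet; `2Mᵢ/Rᵢ ≲ ε` forces `Rᵢ ≥ 4R + 1`);
S1 caps it (rotate `Ξᵢ` by `ρ`); S4′ applied to `(Dc, 𝒟, Ξᵢ ∘ ρ)` gives sub-extremal `(M₁ᵢ, a₁ᵢ)` within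
`η` (hence `|a₁ᵢ| < M₁ᵢ`, masses in `[m₀/4, 4/m₀]`) and late layer charts of vanishing norm inside
`J⁺(Ξᵢ(Wᵢ))`; LAYER-TO-SLAB TRANSFER (far fluxes ⇒ pointwise `C²`, `|h̃| ≲ ϵ r^{-3/4}`; patching the layer
charts into one late Kerr–Schild chart, `SpacetimeLocalConvergenceOfChartsExhaustion*`): near-zone `C²`
convergence on `{t* = σ, r ≤ σ/2}` with honest radii, orientation from the time-oriented charts; FLAT CHART:
Kerr–Schild coordinates outside sublinear tubes (in-cone: `|g − η| ≤ |h̃| + 2Mᵢ/r`), Klainerman–Nicolò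
exterior stability outside the last cones, multi-centre synthesis between cones for `N ≥ 2`
(`MultiCentreRadiationZone`, route FarFieldSynthesis — the one open sub-piece for `N ≥ 2`); EXHAUSTION (ii)
from the causal-future clauses of the charts and global hyperbolicity; `N = 0`: dispersal from the honest
achronal sheet (Minkowski column: `soundSettledCapture_body_minkowski`). Size XL (formal + two printed
theorems + the `N ≥ 2` synthesis). [cite: KlainermanNicolo2003, Thm. 1.1] [cite: ChoquetBruhatGeroch1969CMP, Thm. 3] -/
def TwinAssembly : Prop :=
  ExteriorKerrCapping → RobustCappedCapture → LateConesQuiet → SoundExteriorCaptureT2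

/-- **S7 — RAYS COMPLETION (the existential cut of the T2 rays clause; lines `null-concave-crush` /
`tendril-swarm-rays`).** In a maximal vacuum development of an admissible datum with complete `𝓘⁺`, every
HONEST exterior decomposition (`C²`, sub-extremal labels, `O = exteriorOf 𝒟 d.charted`, exhaustive,
future-oriented) can be replaced by one with the same four properties whose charted region is moreover
COFINALLY VISITED by every future-complete normalised null ray from `Σ` (hole interiors: transported
null-concave crush certificate / Dafermos–Luk off a `CH⁺` collar, `KerrBlackHoleNoCompleteNullRay_holds`,
`exit_of_weightedConcave` p153671; pockets: tendril swarm into `flatDomain`, N ≥ 1 proviso). NOT the universal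
`∀ (O, d)` form (pocket-false: `Lines/birth-dead.md`, stmt-17673's why-it-might-fail). Open (large-data
interior GR outside symmetry classes). [cite: DafermosLuk2017, Thm. 1] -/
def RaysCompletion : Prop :=
  ∀ (X : Type) [TopologicalSpace X] [ChartedSpace E3 X] [IsManifold (𝓡 3) ∞ X] [T2Space X]
    [SecondCountableTopology X] [ConnectedSpace X], ∀ D ∈ admissibleVacuumData X,
    ∀ 𝒟 : VacuumCauchyDevelopment D, 𝒟.IsMaximal →
      Summit.FinalStateConjecture.HasCompleteNullInfinity 𝒟.toCauchyDevelopment →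
      ∀ (O : Set 𝒟.carrier) (d : FinalStateDecomposition 𝒟.toSpacetime O 2),
        (∀ i, Kerr.IsSubextremal (d.mass i) (d.spin i)) →
        O = Summit.FinalStateConjecture.exteriorOf 𝒟.toCauchyDevelopment d.charted →
        Summit.FinalStateConjecture.HasExhaustiveCharts d →
        Summit.FinalStateConjecture.IsFutureOriented d →
        ∃ (O' : Set 𝒟.carrier) (d' : FinalStateDecomposition 𝒟.toSpacetime O' 2),
          (∀ i, Kerr.IsSubextremal (d'.mass i) (d'.spin i)) ∧
            O' = Summit.FinalStateConjecture.exteriorOf 𝒟.toCauchyDevelopment d'.charted ∧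
              Summit.FinalStateConjecture.HasExhaustiveCharts d' ∧
                Summit.FinalStateConjecture.IsFutureOriented d' ∧
                  ∀ [𝒟.metric.HasLeviCivita], ∀ (p : X) (γ : ℝ → 𝒟.carrier) (dom : Set ℝ),
                    𝒟.metric.IsNormalisedNullRayFrom 𝒟.timeOrientation 𝒟.embed 𝒟.normal p γ dom →
                      ¬ BddAbove dom → ∀ t ∈ dom, ∃ t' ∈ dom, t ≤ t' ∧ γ t' ∈ closure d'.charted

/-- Statement of the LANDED causal lemma `stub_visibleRaysStay` (p149576; not a stub of this line). -/
def VisibleRaysStay : Prop :=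
  ∀ (X : Type) [TopologicalSpace X] [ChartedSpace E3 X] [IsManifold (𝓡 3) ∞ X] [T2Space X]
    [SecondCountableTopology X] [ConnectedSpace X], ∀ D ∈ admissibleVacuumData X,
    ∀ 𝒟 : VacuumCauchyDevelopment D, ∀ (O : Set 𝒟.carrier) (d : FinalStateDecomposition 𝒟.toSpacetime O 2),
      O = Summit.FinalStateConjecture.exteriorOf 𝒟.toCauchyDevelopment d.charted →
        ∀ [𝒟.metric.HasLeviCivita], ∀ (p : X) (γ : ℝ → 𝒟.carrier) (dom : Set ℝ),
          𝒟.metric.IsNormalisedNullRayFrom 𝒟.timeOrientation 𝒟.embed 𝒟.normal p γ dom →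
            ∀ t ∈ dom, ∀ t' ∈ dom, 0 ≤ t → t ≤ t' → γ t' ∈ closure d.charted → γ t ∈ closure O

/-! ## §3 The stubs' statements under the stubs' names (the skeleton audit reads the heads of
`SoundSettledCapture_of` BY NAME) -/

namespace Goal
/-- Statement of `stub_hintzClaimAllOrders`: the vendored claim, by name. -/
abbrev stub_hintzClaimAllOrders : Prop :=
  ∀ [Kerr.Facts] [Kerr.SliceFacts], hintz_kerr_stability_subextremal_cauchy_allOrders
/-- Statement of `stub_capping`. -/
abbrev stub_capping : Prop := ExteriorKerrCapping
/-- Statement of `stub_robustCapture`: THE ENGINE, conditional on the claim (as every Hintz-consuming stub of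
the tree, cf. `Cruxes/BulkKerrCaptureC2/Lines/SketchStandalone.lean`). -/
abbrev stub_robustCapture : Prop :=
  (∀ [Kerr.Facts] [Kerr.SliceFacts], hintz_kerr_stability_subextremal_cauchy_allOrders) → RobustCappedCapture
/-- Statement of `stub_lateConesQuiet`. -/
abbrev stub_lateConesQuiet : Prop := LateConesQuiet
/-- Statement of `stub_twinAssembly`. -/
abbrev stub_twinAssembly : Prop := TwinAssembly
/-- Statement of `stub_raysCompletion`. -/
abbrev stub_raysCompletion : Prop := RaysCompletion
end Goal

/-! ## §4 Registered stubs (the ONLY `sorry`s of the file) -/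

/-- stub 0 — **the vendored claim, BY NAME** (`@[claim "Hintz2026" "under-review"]`, p88775): the bet of the
line (barrier `SlowlyRotatingKerrFrontier` is not evaded but bet on). Size XL as mathematics, 0 as Lean once the
fact is citable; discharged only by a `_holds` of the named fact — the item is `blocked-on` it exactly as crux
`BulkKerrCaptureC2` (stub `stub_hintzClaimAllOrders` of `Cruxes/BulkKerrCaptureC2/Lines/SketchStandalone.lean`).
Fallback `klainerman_szeftel_kerr_stability_small_a_cauchy` gives the identical line for `|aᵢ| ≤ α Mᵢ`.
[cite: Hintz2026, Thm. 13.1 (pp. 318–319) and Remark 13.2 (p. 319)] -/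
theorem stub_hintzClaimAllOrders :
    ∀ [Kerr.Facts] [Kerr.SliceFacts], hintz_kerr_stability_subextremal_cauchy_allOrders := by
  sorry

/-- stub 1 — **EXTERIOR KERR CAPPING** (`ExteriorKerrCapping`, S1 of the card; size L; data-level elliptic
gluing, no dynamics). [cite: CorvinoSchoen2006, Thm. 1] -/
theorem stub_capping : ExteriorKerrCapping := by
  sorry

/-- stub 2 — **ROBUST CAPPED CAPTURE, THE ENGINE** (`claim → RobustCappedCapture`, S2+S4 of the card with the
S3 anchoring typed as `InducesDataOn`; size XL / open on two conceded counts). HARDEST STUB.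
[cite: Hintz2026, Thm. 13.1 (pp. 318–319) and Remark 1.3 (p. 3)] -/
theorem stub_robustCapture :
    (∀ [Kerr.Facts] [Kerr.SliceFacts], hintz_kerr_stability_subextremal_cauchy_allOrders) →
      RobustCappedCapture := by
  sorry

/-- stub 3 — **LATE CONES ARE QUIET** (`LateConesQuiet`, S5 of the card; size L–XL; the ε-independent far
input, shared in substance with the sibling levers FAR-TAIL / LEDGER). [cite: KlainermanNicolo2003, Thm. 1.1] -/
theorem stub_lateConesQuiet : LateConesQuiet := by
  sorry

/-- stub 4 — **TWIN ASSEMBLY** (`TwinAssembly`, S3+S6 of the card; size XL; the reduction theorem of the line: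
capping → engine → quiet cones → exterior T2 format). [cite: KlainermanNicolo2003, Thm. 1.1] -/
theorem stub_twinAssembly : TwinAssembly := by
  sorry

/-- stub 5 — **RAYS COMPLETION** (`RaysCompletion`, S7 of the card in the existential cut demanded by the
triage panel; open; served by lines `null-concave-crush` / `tendril-swarm-rays`). [cite: DafermosLuk2017, Thm. 1] -/
theorem stub_raysCompletion : RaysCompletion := by
  sorry

/-- The LANDED causal lemma (p149576), discharged by the tree theorem
`Theorems.BartnikGapSettling.SettledCapture.stub_visibleRaysStay` — not a stub of this line. [folklore] -/
theorem visibleRaysStay : VisibleRaysStay :=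
  Summit.FinalStateConjecture.FinalStateConjecture.Theorems.BartnikGapSettling.SettledCapture.stub_visibleRaysStay

/-! Consistency (elaborated, not kept). -/
example : Goal.stub_hintzClaimAllOrders := stub_hintzClaimAllOrders
example : Goal.stub_capping := stub_capping
example : Goal.stub_robustCapture := stub_robustCapture
example : Goal.stub_lateConesQuiet := stub_lateConesQuiet
example : Goal.stub_twinAssembly := stub_twinAssembly
example : Goal.stub_raysCompletion := stub_raysCompletion

/-! ## §5 The composition (kernel-checked; no `sorry` of its own) -/

/-- **THE RE-TYPED CRUX BY NAME from the six stubs.** The assembly stub, fed the capping stub, the engine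
(itself fed the claim) and the quiet-cones stub, gives the exterior decomposition `(O, d)`; the rays stub
replaces it by `(O′, d′)` with cofinally visible complete rays; for a complete ray and `t ≥ 0` a later visible
parameter `t′` and the landed causal lemma put `γ t` in `closure O′` — that is `RaysStayInClosure 𝒟 O′`.
[folklore] -/
theorem SoundSettledCapture_of :
    Goal.stub_hintzClaimAllOrders → Goal.stub_capping → Goal.stub_robustCapture →
      Goal.stub_lateConesQuiet → Goal.stub_twinAssembly → Goal.stub_raysCompletion →
        SoundSettledCapture := by
  intro hC h₁ h₂ h₃ h₄ h₅ X _ _ _ _ _ _ D hD 𝒟 hmax hscri hleaf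
  have hB : VisibleRaysStay := visibleRaysStay
  obtain ⟨O, d, hsub, hO, hexh, hfut⟩ := h₄ h₁ (h₂ hC) h₃ X D hD 𝒟 hmax hscri hleaf
  obtain ⟨O', d', hsub', hO', hexh', hfut', hvis⟩ := h₅ X D hD 𝒟 hmax hscri O d hsub hO hexh hfut
  refine ⟨O', d', hsub', hO', ?_, hexh', hfut'⟩
  intro inst p γ dom hγ hdom t ht h0
  obtain ⟨t', ht', htt', hv⟩ := hvis p γ dom hγ hdom t ht
  exact hB X D hD 𝒟 O' d' hO' p γ dom hγ t ht t' ht' h0 htt' hv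

/-! ## §6 The TYPED decl (for the record; nothing here is a stub)

`Theses.BartnikGapSettling.SettledCapture → SoundSettledCapture` is the landed
`Retype.soundSettledCapture_of_settledCapture`; the converse — the only thing separating this line from the
typed decl — is paper-FALSE while the typed leaf block idles (THE DODGE) and is deliberately NOT registered:
the typed item is to be restated by the route's tenure planner (signature := body of `SoundSettledCapture`).
-/

/-- The typed crux from the six stubs MODULO the unregistered converse `hconv` (documentation of the
misstatement, not a claim). [folklore] -/
theorem settledCapture_of_converse
    (hconv : SoundSettledCapture →
      Summit.FinalStateConjecture.FinalStateConjecture.Theses.BartnikGapSettling.SettledCapture)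
    (hC : Goal.stub_hintzClaimAllOrders) (h₁ : Goal.stub_capping) (h₂ : Goal.stub_robustCapture)
    (h₃ : Goal.stub_lateConesQuiet) (h₄ : Goal.stub_twinAssembly) (h₅ : Goal.stub_raysCompletion) :
    Summit.FinalStateConjecture.FinalStateConjecture.Theses.BartnikGapSettling.SettledCapture :=
  hconv (SoundSettledCapture_of hC h₁ h₂ h₃ h₄ h₅)

/-- Conversely the typed crux gives the re-typed one outright (landed, p153807). [folklore] -/
example (h : Summit.FinalStateConjecture.FinalStateConjecture.Theses.BartnikGapSettling.SettledCapture) :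
    SoundSettledCapture :=
  Summit.FinalStateConjecture.FinalStateConjecture.Theorems.SettledCapture.Retype.soundSettledCapture_of_settledCapture h

end Summit.FinalStateConjecture.FinalStateConjecture.Cruxes.SettledCapture.KerrCappedTwin

end
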